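import Summits.ResolutionOfSingularities.ResolutionOfSingularities.Theorems.FrobeniusLadderFInjectiveMacaulayficationNonFullLoopFrame
import Summits.ResolutionOfSingularities.ResolutionOfSingularities.Theorems.FrobeniusLadderFInjectiveMacaulayficationNonFullCentreComap
import HarnessLib

/-!
# NEG-A SOCKET: `¬ NonFullTowerConjecture` from the LOCAL conjecture instance at floor 0, NEG-T, and the GLOBAL occurrence chain ending in `U₀`
# (crux `FInjectiveMacaulayfication` stmt-ResolutionOfSingularities-15315, chain w45a; res-L1-w45a-plan-1 R19.21/R19.23/R20.1 «NEG-N», the assembly socket; seat res-L1-w45a-lead-1 g9)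

[OURS · L1 W4.5a] Support file (`--supports stmt-ResolutionOfSingularities-15315 --as helper`); def-free, fact-free; CONDITIONAL on the named floor data (delivered by NEG-0…5);
`NonFullTowerConjecture` is OUR OWN candidate statement — no route item is refuted; nothing of the crux is proved. AI-written (weaker than expert review).

★★ `not_nonFullTowerConjecture_of_local_floor_and_occurrence` = p645060 §5 `NonFullLoopFrame.not_nonFullTowerConjecture_of_occurrence` with its `hfloor` DISCHARGED through NEG-T
(p647370 `RecipeTowerTransfer.exists_recipeTowerFull_nonFullCentre_of_pullback_fromSpecStalk'`): the inputs are exactly what the floor files produce —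
* `π₀ : F 0 ⟶ X` the GLOBAL floor 0 over the specimen `X` with `F 0` FULL off the fibre of the closed point `v` (NEG-0: `X` regular off `v`, `F 0 = Bl_𝔪 X` an iso off `v`, regular ⇒ FULL);
* `hlocal : NonFullTowerConjecture → ∃ n, RecipeTowerFull nonFullCentre 2 n (pullback π₀ (X.fromSpecStalk v))` (NEG-0: the local floor is a legal input of `TowerTerminates`);
* `hg' / hbad` the chain `F 0 ← … ← F m` of blowing ups along the `N_red`-centres with non-FULL floors, `hocc : U₀ ↪ F m` (NEG-1…5), `hlocus` (NEG-5).
-/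

-- single-problem summit: the doubled namespace component is forced
set_option linter.dupNamespace false

noncomputable section

open AlgebraicGeometry CategoryTheory CategoryTheory.Limits Literature.AlgebraicGeometry.Resolution TopologicalSpace IsLocalRing MvPolynomial

namespace Summit.ResolutionOfSingularities.ResolutionOfSingularities.Theorems.FInjectiveMacaulayfication.NonFullLoopFrame

open Summit.ResolutionOfSingularities.ResolutionOfSingularities.Theorems.FInjectiveMacaulayfication
open SliceableCentre IntrinsicTower IntrinsicTower.Recipes FullCentreDescent

/-- ★★ **NEG-A SOCKET.** `¬ NonFullTowerConjecture` from: the loop germ `U₀ = Spec k[X]/(g₅)` with its two-sided locus lemma (`hlocus`, NEG-5); a GLOBAL floor `π₀ : F 0 ⟶ X` FULL off the fibre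
of a closed point `v` (`hfull0`) at whose LOCAL floor `F 0 ×_X Spec 𝒪_{X,v}` the conjecture applies (`hlocal`, NEG-0); a chain of `m` blowing ups along the `N_red`-centres with non-FULL
floors (`hg'`, `hbad`) and an open immersion `U₀ ⟶ F m` (`hocc`, NEG-1…5). [OURS · CONDITIONAL on the named floor data] -/
theorem not_nonFullTowerConjecture_of_local_floor_and_occurrence (k : Type) [Field k] [CharP k 2] (g : MvPolynomial (Fin 5) k)
    (hg : g = X 4 ^ 2 + X 0 ^ 2 * X 1 * X 4 + X 0 * X 1 ^ 2 * X 2 ^ 3 + X 0 * X 1 ^ 2 * X 3 ^ 3 + X 0 * X 1 ^ 2)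
    (hlocus : ∀ w : Spec (.of (MvPolynomial (Fin 5) k ⧸ Ideal.span {g})),
      ¬ FullCl 2 ((Spec (.of (MvPolynomial (Fin 5) k ⧸ Ideal.span {g}))).presheaf.stalk w) ↔
        Ideal.span ((fun j : Fin 5 => Ideal.Quotient.mk (Ideal.span {g}) (X j)) '' (({0, 1, 4} : Finset (Fin 5)) : Set (Fin 5))) ≤ w.asIdeal)
    {Xs : Scheme.{0}} (v : Xs) (hv : IsClosed ({v} : Set Xs))
    (m : ℕ) (F : ℕ → Scheme.{0}) (g' : ∀ i : ℕ, F (i + 1) ⟶ F i) (π₀ : F 0 ⟶ Xs)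
    (hfull0 : ∀ s : F 0, π₀.base s ≠ v → FullCl 2 ((F 0).presheaf.stalk s))
    (hlocal : NonFullTowerConjecture → ∃ n : ℕ, RecipeTowerFull nonFullCentre 2 n (pullback π₀ (Xs.fromSpecStalk v)))
    (hg' : ∀ i, i < m → IsBlowup (g' i) (nonFullCentre 2 (F i)))
    (hbad : ∀ i, i < m → ∃ s : F i, ¬ FullCl 2 ((F i).presheaf.stalk s))
    (hocc : ∃ j : Spec (.of (MvPolynomial (Fin 5) k ⧸ Ideal.span {g})) ⟶ F m, IsOpenImmersion j) :
    ¬ NonFullTowerConjecture :=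
  not_nonFullTowerConjecture_of_occurrence k g hg hlocus m F g'
    (fun hNN => RecipeTowerTransfer.exists_recipeTowerFull_nonFullCentre_of_pullback_fromSpecStalk' 2 π₀ v hv hfull0 (hlocal hNN)) hg' hbad hocc

end Summit.ResolutionOfSingularities.ResolutionOfSingularities.Theorems.FInjectiveMacaulayfication.NonFullLoopFrame

end
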